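import Summits.QuantumFields.YangMills.Theorems.BalabanUVNodesN15DefectKernelVectorPieceTorus
import Summits.QuantumFields.YangMills.Theorems.BalabanUVNodesN15DefectKernelVectorPieceDerivTorus
import Summits.QuantumFields.YangMills.Theorems.BalabanUVNodesN15OperatorReadout
import HarnessLib

/-!
# Route «BalabanUVNodes» (K4 «SpineRates»), node N15 = NE2, -a lane, part 15: THE VECTOR SINGLE-SCALE PIECE AS CONCRETE η-DIFFERENCE OPERATORS —
# King's pairing, Bałaban's `H_k` ∕ `∂_νH_k` ∕ `C^{(k)}` as real linear maps, the Riemann weight `η^{d+1}`, and ENTRY 0 `𝔇(G′, G)` with a UNIFORM majorant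

Cell `pub-ymgap`, seat `pub-ymgap-dag-n15-a` (KNIT-BY-NAME, generation g4; HUMAN RULING D-0062; chair R424 venue; `bears_on: R4∕N15`).  Filed
`--supports stmt-QuantumFields-19351` (helper).  Imports BY NAME, nothing in the tree modified: parts 10 ∕ 14 (this seat g3:
`hasMaj_idef_vectorPiece_unitTorus`, `hasMaj_idef_vectorPieceDeriv_unitTorus`, `hasMaj_idef_vectorPieceAdjDeriv_unitTorus` — the three proved
(3.42)-entries of the piece on the concrete carrier `B6UnitTorusCarrier.unitTorusGeo`, stated for ANY operators read off by entries and ANY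
Riemann weight `w`), n15-b's `…N15.OperatorReadout` (`opGeo`, `opFamily`, `etaRateIneq342_of_hasMaj`: block majorants ⇒ `T4EtaRate.EtaRateIneq342`).

WHY (N15-DOSSIER §6, last paragraph: «the node-vocabulary readout of the vector piece (`OperatorReadout.ne2PlusOperator_of_hasMaj`) needs all FOUR (3.42)
entries: entries 0∕1∕2 are parts 9∕12∕13 (block currency); entry 3 `Δ_UG′` … located, not claimed»).  Parts 9–14 leave the operators, King's pairing and the
Riemann weight as BINDERS and carry `k`-dependent constants inside the displayed majorants.  The readout (part 17) needs: CONCRETE operators (one family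
indexed by the torus, the levels and the direction), the pairing as a MAP, the weight FIXED at `w = η^{d+1} = (L^k)^{−(d+1)}` (Riemann balance `n_η·w = d + 1`),
and ONE constant `B` with the rate factor `(L^k)^{−γ₀}` pulled out.  This file does that for entry 0; part 16 for entries 1–2; part 17 assembles.

CONTENTS (plumbing defs are data, no `Prop`-valued defs; every estimate is a tree theorem BY NAME).
* §1 `kingPr`∕`kingPr_val`∕`kingPrV` (King's pairing `x_μ = ⌊x′_μ∕L^m⌋` of fine points∕bonds, the binder `hpr` of parts 2–14 as a definition);
  `reH`∕`reD`∕`wTranspose`∕`covC` (+ `_single`: Bałaban's `H_k` (1.63), `∂_νH_k`, the weighted transpose `w·Aᵀ`, the (2.156) covariance on unit bonds, as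
  `Matrix.mulVecLin` of the typed kernels — the entry binders `hH`, `hD`, `hK`, `hC` of parts 9–14 discharged by `rfl`-level lemmas); `rweight`∕`card_mul_rweight`∕`rweight_div`
  (the Riemann weight and its balance).
* §2 `blkFine` (fine bonds ↦ King's unit block), **`entry0`∕`entry1`∕`entry2`** := `𝔇(G′,G)`, `𝔇(∂′_νG′,∂_νG)`, `𝔇(G′∂′_ν*,G∂_ν*)` for
  `G = H_k·C^{(k)}·(η^{d+1}H_kᵀ)` against its `η′ = L^{−m}η` twin, through `pull kingPrV` (`T4EtaRateDefect.idef`); `inv_pow_le_rpow`;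
  **`hasMaj_entry0`**: `∃ B, δ₁ > 0`, for every unit torus `Π ℤ∕M_ν` with `L ∣ M_ν`, all `k`, `m ≥ 1`, `0 ≤ ρ ≤ δ₁`: `HasMaj … entry0 … (B·(L^k)⁻¹·e^{−ρ|y−y′|_T})`
  (part 10 at `w = η^{d+1}`: every summand of its majorant carries exactly one rate factor `(L^k)⁻¹`, so it IS `B′·(L^k)⁻¹·e^{−ρd}`, `B = B′ + 1`).

HONEST FRAMING ∕ LIMITS.  `U = 1` LINEAR theory on FINITE tori (b05∕b06 torus model), `d + 1 ≥ 2`, ONE single-scale piece in King's (4.42) SHAPE with Bałaban's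
vector factors; NOT [B6]'s multiscale expansion (NODE 00), NOT the telescoping over `j`; nothing with background (NE2⁺ proper NOT PRINTED ∕ not proved);
the fourth (3.42) entry `Δ_UG′` is NOT here (part 17 takes it as the one displayed binder).  Count-neutral (typed 28∕28 · discharged unchanged); NOT a
discharge of N15; one finite T⁴ at fixed ε — NOT infinite volume, NOT OS on ℝ⁴, NOT a mass gap, NOT Clay.
-/

noncomputable section

open scoped BigOperators
open Finset

namespace Summit.QuantumFields.YangMills.BalabanUVNodes.N15.VectorPiece

open Literature.MathematicalPhysics.QuantumFieldTheory.Balaban1983to89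
open Literature.MathematicalPhysics.QuantumFieldTheory.Balaban1983to89.B11SectG (BlockNorm HasMaj)
open Literature.MathematicalPhysics.QuantumFieldTheory.Balaban1983to89.T4EtaRate (PairedInstance EtaPairing EtaRateIneq342 NE2PlusOperator
  NE2ZeroOperator rateFactor)
open Literature.MathematicalPhysics.QuantumFieldTheory.Balaban1983to89.T4EtaRateDefect (idef rateWeight)
open Literature.MathematicalPhysics.QuantumFieldTheory.Balaban1983to89.T4EtaRateDefectSite (pt9Bg)
open Literature.MathematicalPhysics.QuantumFieldTheory.Balaban1983to89.T4EtaRateCoeffDefect (pull)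
open Literature.MathematicalPhysics.QuantumFieldTheory.Balaban1983to89.B4TorusKernel (periodConst)
open Literature.MathematicalPhysics.QuantumFieldTheory.Balaban1983to89.B5Prop11Plancherel (Tor fine fdiff)
open Literature.MathematicalPhysics.QuantumFieldTheory.Balaban1983to89.B5Hk163Strip (kappa163 kappa163_pos)
open Literature.MathematicalPhysics.QuantumFieldTheory.Balaban1983to89.B5Hk163Decay (MG163)
open Literature.MathematicalPhysics.QuantumFieldTheory.Balaban1983to89.B5Hk163Torus (HkOp)
open Literature.MathematicalPhysics.QuantumFieldTheory.Balaban1983to89.B5Hk163TorusHolderDecay (MD163)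
open Literature.MathematicalPhysics.QuantumFieldTheory.Balaban1983to89.B5Hk163RateSum (C0maj C1maj T163)
open Literature.MathematicalPhysics.QuantumFieldTheory.Balaban1983to89.T4Hk163StripRate (CGe)
open Literature.MathematicalPhysics.QuantumFieldTheory.Balaban1983to89.B6LowerBound2153Torus (rep rep_mem_pbox)
open Literature.MathematicalPhysics.QuantumFieldTheory.Balaban1983to89.B6Lemma24Torus (pbox)
open Literature.MathematicalPhysics.QuantumFieldTheory.Balaban1983to89.B6Cov2156Torus (deltaPol bondReductionT)
open Literature.MathematicalPhysics.QuantumFieldTheory.Balaban1983to89.B6UnitTorusCarrier (unitTorusGeo unitTorusGeo_len)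
open Literature.MathematicalPhysics.QuantumFieldTheory.King1986 (aliasConst)
open Literature.MathematicalPhysics.QuantumFieldTheory.King1986.Torus (tdistT tdistT_nonneg)
open Summit.QuantumFields.YangMills.BalabanUVNodes.N15.OperatorReadout (opGeo opFamily opGeo_len rateFactor_opGeo etaRateIneq342_of_hasMaj)
open Summit.QuantumFields.YangMills.BalabanUVNodes.N15.DefectKernel (hasMaj_idef_vectorPiece_unitTorus hasMaj_idef_vectorPieceDeriv_unitTorus
  hasMaj_idef_vectorPieceAdjDeriv_unitTorus)

variable {d : ℕ}

/-! ## §1 Plumbing: King's pairing of fine bonds, Bałaban's objects read as real linear maps, the Riemann weight -/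

section Plumbing

/-- KING'S PAIRING of fine points, `x_μ = ⌊x′_μ ∕ L^m⌋` («When x′ ∈ T_{η′}, we denote by x that point in T_η for which x′ ∈ B^n(x)»), as a map
`Π ℤ∕(L^mL^kM_μ) → Π ℤ∕(L^kM_μ)`. [cite: King1986, p.664 (convention before Prop. 3.8)] -/
def kingPr (L k m : ℕ) (M : Fin (d + 1) → ℕ) (x' : Tor (fine (L ^ m * L ^ k) M)) : Tor (fine (L ^ k) M) :=
  fun μ => (((x' μ).val / L ^ m : ℕ) : ZMod (fine (L ^ k) M μ))

/-- `(pr x′)_μ = ⌊x′_μ ∕ L^m⌋` on residues. [cite: King1986, p.664 (convention before Prop. 3.8)] -/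
theorem kingPr_val (L k m : ℕ) [NeZero L] (M : Fin (d + 1) → ℕ) [∀ μ, NeZero (M μ)] (x' : Tor (fine (L ^ m * L ^ k) M))
    (μ : Fin (d + 1)) : (kingPr L k m M x' μ).val = (x' μ).val / L ^ m := by
  have hlt : (x' μ).val < L ^ m * L ^ k * M μ := ZMod.val_lt (x' μ)
  have hdiv : (x' μ).val / L ^ m < L ^ k * M μ := Nat.div_lt_of_lt_mul (by rw [← mul_assoc]; exact hlt)
  show (((x' μ).val / L ^ m : ℕ) : ZMod (L ^ k * M μ)).val = (x' μ).val / L ^ m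
  rw [ZMod.val_natCast, Nat.mod_eq_of_lt hdiv]

/-- King's pairing of fine BONDS: same direction, paired base points. [cite: King1986, p.664 (convention before Prop. 3.8)] -/
def kingPrV (L k m : ℕ) (M : Fin (d + 1) → ℕ) (i : Tor (fine (L ^ m * L ^ k) M) × Fin (d + 1)) :
    Tor (fine (L ^ k) M) × Fin (d + 1) :=
  (kingPr L k m M i.1, i.2)

/-- Unfolding of the bond pairing. [folklore] -/
theorem kingPrV_eq (L k m : ℕ) (M : Fin (d + 1) → ℕ) (i : Tor (fine (L ^ m * L ^ k) M) × Fin (d + 1)) :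
    kingPrV L k m M i = (kingPr L k m M i.1, i.2) := rfl

/-- Bałaban's `H_k` of (1.63) (the typed torus operator `B5Hk163Torus.HkOp`, real parts of its entries) as a real linear map from unit-lattice
1-forms to fine 1-forms. [cite: Balaban1984PropagatorsI, (1.63) p.28] -/
def reH (M : Fin (d + 1) → ℕ) [∀ μ, NeZero (M μ)] (n : ℕ) [NeZero n] :
    (Tor M × Fin (d + 1) → ℝ) →ₗ[ℝ] (Tor (fine n M) × Fin (d + 1) → ℝ) :=
  Matrix.mulVecLin ((HkOp n M).map Complex.reLm)

/-- Entries of `reH`. [folklore] -/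
theorem reH_single (M : Fin (d + 1) → ℕ) [∀ μ, NeZero (M μ)] (n : ℕ) [NeZero n] (b : Tor M × Fin (d + 1))
    (i : Tor (fine n M) × Fin (d + 1)) : reH M n (Pi.single b 1) i = (HkOp n M i b).re := by
  simp [reH, Matrix.mulVec, dotProduct, Pi.single_apply, Matrix.map_apply]

/-- The derivative `∂_νH_k` (fine forward difference quotient of (1.63), real parts) as a real linear map. [cite: Balaban1984PropagatorsI, (1.63) p.28, (1.21) p.21 (the difference quotient)] -/
def reD (M : Fin (d + 1) → ℕ) [∀ μ, NeZero (M μ)] (n : ℕ) [NeZero n] (ν : Fin (d + 1)) :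
    (Tor M × Fin (d + 1) → ℝ) →ₗ[ℝ] (Tor (fine n M) × Fin (d + 1) → ℝ) :=
  Matrix.mulVecLin ((fdiff (fine n M) ((n : ℕ) : ℂ) ν * HkOp n M).map Complex.reLm)

/-- Entries of `reD`. [folklore] -/
theorem reD_single (M : Fin (d + 1) → ℕ) [∀ μ, NeZero (M μ)] (n : ℕ) [NeZero n] (ν : Fin (d + 1)) (b : Tor M × Fin (d + 1))
    (i : Tor (fine n M) × Fin (d + 1)) :
    reD M n ν (Pi.single b 1) i = ((fdiff (fine n M) ((n : ℕ) : ℂ) ν * HkOp n M) i b).re := by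
  simp [reD, Matrix.mulVec, dotProduct, Pi.single_apply, Matrix.map_apply]

/-- The Riemann-weighted transpose `w·Aᵀ` of a fine-from-unit operator (King's `Q_kG_k` factor: the coarse-run weight is `w = η^{d+1}`).
[cite: King1986, (4.42) p.675 (the factor Q_kG_k)] -/
def wTranspose (M : Fin (d + 1) → ℕ) [∀ μ, NeZero (M μ)] (n : ℕ) [NeZero n] (w : ℝ)
    (A : (Tor M × Fin (d + 1) → ℝ) →ₗ[ℝ] (Tor (fine n M) × Fin (d + 1) → ℝ)) :
    (Tor (fine n M) × Fin (d + 1) → ℝ) →ₗ[ℝ] (Tor M × Fin (d + 1) → ℝ) :=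
  Matrix.mulVecLin (w • (LinearMap.toMatrix' A).transpose)

/-- Entries of the weighted transpose. [folklore] -/
theorem wTranspose_single (M : Fin (d + 1) → ℕ) [∀ μ, NeZero (M μ)] (n : ℕ) [NeZero n] (w : ℝ)
    (A : (Tor M × Fin (d + 1) → ℝ) →ₗ[ℝ] (Tor (fine n M) × Fin (d + 1) → ℝ)) (i : Tor (fine n M) × Fin (d + 1)) (b : Tor M × Fin (d + 1)) :
    wTranspose M n w A (Pi.single i 1) b = w * A (Pi.single b 1) i := by
  simp [wTranspose, LinearMap.toMatrix'_apply]

/-- The (2.156) unit-lattice covariance `C^{(k)}_T = C(C*Δ_kC)⁻¹C*` of the torus model (`B6Cov2156Torus.bondReductionT … .cov` at `Δ_k = deltaPol M n`),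
read on unit bonds through the canonical indexing `(y, λ) ↦ (rep y, λ)` by box representatives. [cite: Balaban1984PropagatorsII, (2.156) p.250] -/
def covC (L : ℕ) (M : Fin (d + 1) → ℕ) [∀ μ, NeZero (M μ)] (n : ℕ) : (Tor M × Fin (d + 1) → ℝ) →ₗ[ℝ] (Tor M × Fin (d + 1) → ℝ) :=
  Matrix.mulVecLin (Matrix.of fun b b' : Tor M × Fin (d + 1) =>
    (bondReductionT L M (deltaPol M n)).cov (⟨rep M b.1, rep_mem_pbox M b.1⟩, b.2) (⟨rep M b'.1, rep_mem_pbox M b'.1⟩, b'.2))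

/-- Entries of `covC`. [folklore] -/
theorem covC_single (L : ℕ) (M : Fin (d + 1) → ℕ) [∀ μ, NeZero (M μ)] (n : ℕ) (b b' : Tor M × Fin (d + 1)) :
    covC L M n (Pi.single b' 1) b =
      (bondReductionT L M (deltaPol M n)).cov (⟨rep M b.1, rep_mem_pbox M b.1⟩, b.2) (⟨rep M b'.1, rep_mem_pbox M b'.1⟩, b'.2) := by
  simp [covC, Matrix.mulVec, dotProduct, Pi.single_apply]

/-- THE RIEMANN WEIGHT `w = η^{d+1} = (L^k)^{−(d+1)}` of the coarse run (so that `n_η·w = d + 1` for the `(d+1)(L^k)^{d+1}` fine bonds over a unit block).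
[cite: King1986, (4.42) p.675 (Riemann sums over blocks)] -/
def rweight (L k : ℕ) : ℝ := ((((L : ℝ) ^ k) ^ (d + 1)))⁻¹

/-- The Riemann balance `n_η·w = d + 1`. [folklore] -/
theorem card_mul_rweight {L : ℕ} (hL : L ≠ 0) (k : ℕ) : ((((d + 1) * (L ^ k) ^ (d + 1) : ℕ) : ℝ)) * rweight (d := d) L k = ((d + 1 : ℕ) : ℝ) := by
  have hx : ((L : ℝ) ^ k) ^ (d + 1) ≠ 0 := pow_ne_zero _ (pow_ne_zero _ (Nat.cast_ne_zero.mpr hL))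
  unfold rweight
  push_cast
  field_simp

/-- `0 ≤ w`. [folklore] -/
theorem rweight_nonneg (L k : ℕ) : 0 ≤ rweight (d := d) L k := by unfold rweight; positivity

/-- `w ∕ (L^m)^{d+1}` is the fine run's Riemann weight `(L^{k+m})^{−(d+1)}`. [folklore] -/
theorem rweight_div (L k m : ℕ) : rweight (d := d) L k / ((L : ℝ) ^ m) ^ (d + 1) = rweight (d := d) L (k + m) := by
  unfold rweight
  rw [show ((L : ℝ) ^ (k + m)) = (L : ℝ) ^ k * (L : ℝ) ^ m from pow_add _ _ _, mul_pow, mul_inv, div_eq_mul_inv]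

end Plumbing

/-! ## §2 The three (3.42) entries of the vector single-scale piece as CONCRETE η-difference operators, with UNIFORM majorants `B·(L^k)^{−γ₀}·e^{−ρ|y−y′|_T}` -/

section Entries

variable (L k m : ℕ) [NeZero L] (M : Fin (d + 1) → ℕ) [∀ μ, NeZero (M μ)]

/-- The unit-block assignment of the coarse run's fine bonds: `(x, μ) ↦ B(x)` (King's unit block of the base point). [cite: King1986, p.664 (blocks B^k(x))] -/
def blkFine (L k : ℕ) [NeZero L] (M : Fin (d + 1) → ℕ) [∀ μ, NeZero (M μ)] (i : Tor (fine (L ^ k) M) × Fin (d + 1)) : Tor M :=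
  Literature.MathematicalPhysics.QuantumFieldTheory.King1986.Torus.blockOf (L ^ k) M i.1

/-- ENTRY 0 — `𝔇(G′, G)` for the piece `G = H_k·C^{(k)}·(w·H_kᵀ)` against its `η′ = L^{−m}η` twin, through King's pairing of fine bonds.
[cite: Balaban1985BackgroundPropagators, (3.42) p.397 (first entry, shape); King1986, (4.42) p.675 (the piece)] -/
def entry0 : (Tor (fine (L ^ k) M) × Fin (d + 1) → ℝ) →ₗ[ℝ] (Tor (fine (L ^ m * L ^ k) M) × Fin (d + 1) → ℝ) :=
  idef (pull (kingPrV L k m M)) (pull (kingPrV L k m M))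
    (reH M (L ^ m * L ^ k) ∘ₗ (covC L M (L ^ (k + m)) ∘ₗ
      wTranspose M (L ^ m * L ^ k) (rweight (d := d) L k / ((L : ℝ) ^ m) ^ (d + 1)) (reH M (L ^ m * L ^ k))))
    (reH M (L ^ k) ∘ₗ (covC L M (L ^ k) ∘ₗ wTranspose M (L ^ k) (rweight (d := d) L k) (reH M (L ^ k))))

/-- ENTRY 1 (direction `ν`) — `𝔇(∂′_νG′, ∂_νG)` for the piece. [cite: Balaban1985BackgroundPropagators, (3.42) p.397 (second entry, shape); King1986, (4.42) p.675] -/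
def entry1 (ν : Fin (d + 1)) : (Tor (fine (L ^ k) M) × Fin (d + 1) → ℝ) →ₗ[ℝ] (Tor (fine (L ^ m * L ^ k) M) × Fin (d + 1) → ℝ) :=
  idef (pull (kingPrV L k m M)) (pull (kingPrV L k m M))
    (reD M (L ^ m * L ^ k) ν ∘ₗ (covC L M (L ^ (k + m)) ∘ₗ
      wTranspose M (L ^ m * L ^ k) (rweight (d := d) L k / ((L : ℝ) ^ m) ^ (d + 1)) (reH M (L ^ m * L ^ k))))
    (reD M (L ^ k) ν ∘ₗ (covC L M (L ^ k) ∘ₗ wTranspose M (L ^ k) (rweight (d := d) L k) (reH M (L ^ k))))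

/-- ENTRY 2 (direction `ν`) — `𝔇(G′∂′_ν*, G∂_ν*)` for the piece (the right factor the weighted transpose of `∂_νH_k`). [cite: Balaban1985BackgroundPropagators, (3.42) p.397 (third entry, shape); King1986, (4.42) p.675] -/
def entry2 (ν : Fin (d + 1)) : (Tor (fine (L ^ k) M) × Fin (d + 1) → ℝ) →ₗ[ℝ] (Tor (fine (L ^ m * L ^ k) M) × Fin (d + 1) → ℝ) :=
  idef (pull (kingPrV L k m M)) (pull (kingPrV L k m M))
    (reH M (L ^ m * L ^ k) ∘ₗ (covC L M (L ^ (k + m)) ∘ₗ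
      wTranspose M (L ^ m * L ^ k) (rweight (d := d) L k / ((L : ℝ) ^ m) ^ (d + 1)) (reD M (L ^ m * L ^ k) ν)))
    (reH M (L ^ k) ∘ₗ (covC L M (L ^ k) ∘ₗ wTranspose M (L ^ k) (rweight (d := d) L k) (reD M (L ^ k) ν)))

end Entries

section Majorants

variable {L : ℕ} [NeZero L]

omit [NeZero L] in
/-- `(L^k)⁻¹ ≤ (L^k)^{−γ₀}` for `L ≥ 1`, `γ₀ ≤ 1`. [folklore] -/
theorem inv_pow_le_rpow (hL : 1 ≤ L) (k : ℕ) {γ₀ : ℝ} (h1 : γ₀ ≤ 1) :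
    ((L : ℝ) ^ k)⁻¹ ≤ ((L : ℝ) ^ k) ^ (-γ₀) := by
  have hx : (1 : ℝ) ≤ (L : ℝ) ^ k := one_le_pow₀ (by exact_mod_cast hL)
  rw [← Real.rpow_neg_one]
  exact Real.rpow_le_rpow_of_exponent_le hx (by linarith)


/-- **ENTRY 0 WITH A UNIFORM MAJORANT** (part 10 `hasMaj_idef_vectorPiece_unitTorus` at the Riemann weight `w = (L^k)^{−(d+1)}`, every constant collected):
`∃ B, δ₁ > 0` such that for every unit torus `Π ℤ∕M_ν` with `L ∣ M_ν`, all `k`, `m ≥ 1`, `0 ≤ ρ ≤ δ₁`: `𝔇(G′, G)` has the block majorant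
`B·(L^k)⁻¹·e^{−ρ|y−y′|_T}` between the sharp cube norms of the fine-bond assignments. [cite: King1986, (4.42)–(4.43) p.675; Balaban1984PropagatorsI, (1.63) p.28; Balaban1984PropagatorsII, (2.156) p.250] -/
theorem hasMaj_entry0 (hd : 1 ≤ d) (hL : 1 ≤ L) :
    ∃ B δ₁ : ℝ, 0 < B ∧ 0 < δ₁ ∧ ∀ (M : Fin (d + 1) → ℕ) [∀ μ, NeZero (M μ)] (_ : ∀ i, L ∣ M i) (k m : ℕ) (_ : 1 ≤ m)
      {ρ : ℝ} (_ : 0 ≤ ρ) (_ : ρ ≤ δ₁),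
      HasMaj (BlockNorm.ofBlocks (unitTorusGeo L k M) (blkFine L k M))
        (BlockNorm.ofBlocks (unitTorusGeo L k M) (blkFine L k M ∘ kingPrV L k m M))
        (entry0 (d := d) L k m M) (fun y y' => B * ((L : ℝ) ^ k)⁻¹ * Real.exp (-(ρ * tdistT M y y'))) := by
  obtain ⟨B₀, C₁, δ', hB₀, hC₁, hδ', HP⟩ := hasMaj_idef_vectorPiece_unitTorus (d := d) hd hL
  have hL0 : L ≠ 0 := by omega
  have hpC0 : 0 ≤ periodConst (kappa163 (d + 1)) d := (B5Kernel166Decay.periodConst_pos (kappa163_pos _) d).le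
  have hMG : 0 ≤ MG163 (d + 1) := B5Hk163Decay.MG163_nonneg _
  have hσ : 0 < min (kappa163 (d + 1) / (d + 1)) δ' / 2 := half_pos (lt_min (div_pos (kappa163_pos _) (by positivity)) hδ')
  have hcr0 : 0 ≤ B4Sect5Proof.latticeConst (d + 1) (min (kappa163 (d + 1) / (d + 1)) δ' / 2) :=
    B4Sect5Proof.latticeConst_nonneg (d + 1) hσ.le
  have hMD : 0 ≤ MD163 (d + 1) :=
    (mul_nonneg_iff_of_pos_right (B5Kernel166Decay.periodConst_pos (kappa163_pos _) d)).mp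
      (B5Hk163TorusHolderDecay.CdecD_nonneg (d := d))
  have hCGe : 0 ≤ CGe (d + 1) := T4Hk163StripRate.CGe_nonneg _
  -- the uniform constant (every summand of part 10's majorant carries exactly one rate factor `(L^k)⁻¹`)
  refine ⟨((d + 1 : ℕ) : ℝ) * (MG163 (d + 1) * periodConst (kappa163 (d + 1)) d) *
        B4Sect5Proof.latticeConst (d + 1) (min (kappa163 (d + 1) / (d + 1)) δ' / 2) *
        (((d + 1 : ℕ) : ℝ) * B₀ * B4Sect5Proof.latticeConst (d + 1) (min (kappa163 (d + 1) / (d + 1)) δ' / 2) *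
            (((d + 1 : ℕ) : ℝ) * ((CGe (d + 1) + (d + 1) * MD163 (d + 1)) * periodConst (kappa163 (d + 1)) d))
          + ((d + 1 : ℕ) : ℝ) * C₁ * B4Sect5Proof.latticeConst (d + 1) (min (kappa163 (d + 1) / (d + 1)) δ' / 2) *
            (((d + 1 : ℕ) : ℝ) * (MG163 (d + 1) * periodConst (kappa163 (d + 1)) d)))
      + ((d + 1 : ℕ) : ℝ) * ((CGe (d + 1) + (d + 1) * MD163 (d + 1)) * periodConst (kappa163 (d + 1)) d) *
        B4Sect5Proof.latticeConst (d + 1) (min (kappa163 (d + 1) / (d + 1)) δ' / 2) *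
        (((d + 1 : ℕ) : ℝ) * B₀ * B4Sect5Proof.latticeConst (d + 1) (min (kappa163 (d + 1) / (d + 1)) δ' / 2) *
          (((d + 1 : ℕ) : ℝ) * (MG163 (d + 1) * periodConst (kappa163 (d + 1)) d))) + 1,
    min (kappa163 (d + 1) / (d + 1)) δ' / 2, by positivity, hσ, ?_⟩
  intro M _ hLM k m hm ρ hρ hρ1
  have key := HP M hLM k m hm (kingPr L k m M) (kingPr_val L k m M) (kingPrV L k m M) (fun _ => rfl)
    (reH M (L ^ k)) (reH_single M (L ^ k)) (reH M (L ^ m * L ^ k)) (reH_single M (L ^ m * L ^ k))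
    (rweight_nonneg (d := d) L k)
    (wTranspose M (L ^ k) (rweight (d := d) L k) (reH M (L ^ k))) (wTranspose_single M (L ^ k) (rweight (d := d) L k) (reH M (L ^ k)))
    (wTranspose M (L ^ m * L ^ k) (rweight (d := d) L k / ((L : ℝ) ^ m) ^ (d + 1)) (reH M (L ^ m * L ^ k)))
    (wTranspose_single M (L ^ m * L ^ k) (rweight (d := d) L k / ((L : ℝ) ^ m) ^ (d + 1)) (reH M (L ^ m * L ^ k)))
    (covC L M (L ^ k)) (covC_single L M (L ^ k)) (covC L M (L ^ (k + m))) (covC_single L M (L ^ (k + m))) hρ hρ1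
  refine key.mono fun y y' => ?_
  have hbal := card_mul_rweight (d := d) hL0 k
  have hcast : ((L ^ k : ℕ) : ℝ) = (L : ℝ) ^ k := by push_cast; ring
  rw [hbal, hcast]
  have hE : 0 ≤ Real.exp (-(ρ * tdistT M y y')) := Real.exp_nonneg _
  have hx : 0 < ((L : ℝ) ^ k)⁻¹ := inv_pos.mpr (pow_pos (by exact_mod_cast (show 0 < L by omega)) _)
  have heq : ∀ (E X : ℝ),
      (((d + 1 : ℕ) : ℝ) * (MG163 (d + 1) * periodConst (kappa163 (d + 1)) d) *
            B4Sect5Proof.latticeConst (d + 1) (min (kappa163 (d + 1) / (d + 1)) δ' / 2) *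
          (((d + 1 : ℕ) : ℝ) * B₀ * B4Sect5Proof.latticeConst (d + 1) (min (kappa163 (d + 1) / (d + 1)) δ' / 2) *
              (((d + 1 : ℕ) : ℝ) * ((CGe (d + 1) + (d + 1) * MD163 (d + 1)) * periodConst (kappa163 (d + 1)) d / ((L : ℝ) ^ k)))
            + ((d + 1 : ℕ) : ℝ) * (C₁ * ((L : ℝ) ^ k)⁻¹) *
                B4Sect5Proof.latticeConst (d + 1) (min (kappa163 (d + 1) / (d + 1)) δ' / 2) *
              (((d + 1 : ℕ) : ℝ) * (MG163 (d + 1) * periodConst (kappa163 (d + 1)) d)))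
        + ((d + 1 : ℕ) : ℝ) * ((CGe (d + 1) + (d + 1) * MD163 (d + 1)) * periodConst (kappa163 (d + 1)) d / ((L : ℝ) ^ k)) *
            B4Sect5Proof.latticeConst (d + 1) (min (kappa163 (d + 1) / (d + 1)) δ' / 2) *
          (((d + 1 : ℕ) : ℝ) * B₀ * B4Sect5Proof.latticeConst (d + 1) (min (kappa163 (d + 1) / (d + 1)) δ' / 2) *
            (((d + 1 : ℕ) : ℝ) * (MG163 (d + 1) * periodConst (kappa163 (d + 1)) d)))) * E
      = (((d + 1 : ℕ) : ℝ) * (MG163 (d + 1) * periodConst (kappa163 (d + 1)) d) *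
        B4Sect5Proof.latticeConst (d + 1) (min (kappa163 (d + 1) / (d + 1)) δ' / 2) *
        (((d + 1 : ℕ) : ℝ) * B₀ * B4Sect5Proof.latticeConst (d + 1) (min (kappa163 (d + 1) / (d + 1)) δ' / 2) *
            (((d + 1 : ℕ) : ℝ) * ((CGe (d + 1) + (d + 1) * MD163 (d + 1)) * periodConst (kappa163 (d + 1)) d))
          + ((d + 1 : ℕ) : ℝ) * C₁ * B4Sect5Proof.latticeConst (d + 1) (min (kappa163 (d + 1) / (d + 1)) δ' / 2) *
            (((d + 1 : ℕ) : ℝ) * (MG163 (d + 1) * periodConst (kappa163 (d + 1)) d)))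
      + ((d + 1 : ℕ) : ℝ) * ((CGe (d + 1) + (d + 1) * MD163 (d + 1)) * periodConst (kappa163 (d + 1)) d) *
        B4Sect5Proof.latticeConst (d + 1) (min (kappa163 (d + 1) / (d + 1)) δ' / 2) *
        (((d + 1 : ℕ) : ℝ) * B₀ * B4Sect5Proof.latticeConst (d + 1) (min (kappa163 (d + 1) / (d + 1)) δ' / 2) *
          (((d + 1 : ℕ) : ℝ) * (MG163 (d + 1) * periodConst (kappa163 (d + 1)) d)))) * ((L : ℝ) ^ k)⁻¹ * E := by
    intro E X; ring
  rw [heq _ 0]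
  exact mul_le_mul_of_nonneg_right (mul_le_mul_of_nonneg_right (le_add_of_nonneg_right zero_le_one) hx.le) hE


end Majorants

end Summit.QuantumFields.YangMills.BalabanUVNodes.N15.VectorPiece
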